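import Literature.NumberTheory.LFunctions.FeketePolyaKernelCertificatesBlockWrappers
import HarnessLib

/-!
# No real zero for real primitive characters of conductor `15893 ≤ q ≤ 16567`: the Fekete–Pólya rows, in the kernel (rows deferred by the earlier engines)

Topic `Literature/NumberTheory/LFunctions`; namespace `Literature.NumberTheory.LFunctions`. THEOREMS only (no
definition, no named fact, no `sorry`; standard axioms): one PUBLIC theorem **`noRealZero{Odd,Even}_fp_<q>`** per
fundamental discriminant `D`, `|D| = q ∈ [15893, 16567]`, that admits a Fekete–Pólya witness but was DEFERRED by the per-position engines v1/v2 (walk too long for one `decide`) — for every primitive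
quadratic `χ` mod `q` of the parity of `D` and every `σ ∈ (0, 1)`, `L(σ, χ) ≠ 0` (statement shape of the
`interval_cases` bullets of the `NoRealZero{Odd,Even}…` range files, so a range assembly cites them by name).
Cell `parity-realchar`, kernel floor of the wide column (TARGET §2 row 19), Fekete–Pólya lane (seat prover-2).

Method (engine v4): `FeketePolyaKernelCertificatesBlock{,Wrappers}.lean` — the iterated partial sums of order
`K` of the induced character `χ↑(q·w)` are non-negative over one period, decided in the kernel BLOCKWISE on packed
base-`2^b` digits (`blockCert b B K (q·w) (tabs… b ps q w)`: sign tables of the character from the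
quadratic-residue bitsets of the prime factors of the conductor — the factor list is part of each certificate,
primality by `norm_num` — prefix sums by one big-integer multiplication per order and block, sign test by one
AND), hence `ℜL(σ, χ↑(q·w)) > 0` (Fekete–Pólya 1912 / MV §11.2.1 Exercise 7) and `L(σ, χ) ≠ 0` (positive Euler
factors, Exercise 8).  Witnesses `(w, K)` = the cheapest in the exact integer scan of this seat
(`HOME/parity-realchar-prover-2/fp-witnesses-*.tsv`; no kit); the digit width `b` is two bits above the size of
the running-sum bound recorded by the scan.  14 characters in this file (est. 78 kernel-s).
NOT covered here (no Fekete–Pólya witness with `w ≤ 40`, `q·w ≤ 4·10⁵`, `K ≤ 12`; the other Fekete–Pólya rows of this range are in the `NoRealZeroFeketePolyaX…` files) — left to the truncation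
certificates of the companion lane: see those files.

## References

* H. L. Montgomery, R. C. Vaughan, *Multiplicative Number Theory I*, CUP 2007, §9.3 Thm 9.13, §11.2.1
  Exercises 7–8. [MontgomeryVaughan2007]
* M. Fekete, G. Pólya, *Über ein Problem von Laguerre*, Rend. Circ. Mat. Palermo 34 (1912) 89–120. [FeketePolya1912]
-/

namespace Literature.NumberTheory.LFunctions

open FeketePolyaKernel

set_option maxHeartbeats 400000 in
/-- `D = 15893`: the even character `(·/15893)` of conductor `15893` (`15893`: 23 · 691) — Fekete–Pólya witness of order `8` along the induced modulus `15893·6 = 95358`, block certificate (digits of `111` bits, splitting depth `9`); est. `4.1` kernel-s. [cite: MontgomeryVaughan2007, §11.2.1 Exercises 7 (g), 8] -/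
theorem noRealZeroEven_fp_15893 :
    ∀ χ : DirichletCharacter ℂ 15893, χ.IsQuadratic → χ.IsPrimitive → χ.Even →
      ∀ σ : ℝ, 0 < σ → σ < 1 → χ.LFunction σ ≠ 0 :=
  good_even_of_odd_blk [23, 691] (by norm_num) (by decide) (by decide) 6 8 111 9 (by decide) (by decide) (by decide)
    (Or.inr (by decide +kernel))

set_option maxHeartbeats 400000 in
/-- `D = -15983`: the odd character `(·/15983)` of conductor `15983` (`15983`: 11 · 1453) — Fekete–Pólya witness of order `4` along the induced modulus `15983·13 = 207779`, block certificate (digits of `60` bits, splitting depth `9`); est. `2.9` kernel-s. [cite: MontgomeryVaughan2007, §11.2.1 Exercises 7 (g), 8] -/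
theorem noRealZeroOdd_fp_15983 :
    ∀ χ : DirichletCharacter ℂ 15983, χ.IsQuadratic → χ.IsPrimitive → χ.Odd →
      ∀ σ : ℝ, 0 < σ → σ < 1 → χ.LFunction σ ≠ 0 :=
  good_odd_of_odd_blk [11, 1453] (by norm_num) (by decide) (by decide) 13 4 60 9 (by decide) (by decide) (by decide)
    (Or.inr (by decide +kernel))

set_option maxHeartbeats 400000 in
/-- `D = -15988`: the odd character `χ₋₄·(·/3997)` of conductor `15988` (`3997`: 7 · 571) — Fekete–Pólya witness of order `7` along the induced modulus `15988·15 = 239820`, block certificate (digits of `106` bits, splitting depth `10`); est. `8.7` kernel-s. [cite: MontgomeryVaughan2007, §11.2.1 Exercises 7 (g), 8] -/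
theorem noRealZeroOdd_fp_15988 :
    ∀ χ : DirichletCharacter ℂ 15988, χ.IsQuadratic → χ.IsPrimitive → χ.Odd →
      ∀ σ : ℝ, 0 < σ → σ < 1 → χ.LFunction σ ≠ 0 :=
  good_odd_of_four_blk [7, 571] (by norm_num) (by decide) (by decide) 15 7 106 10 (by decide) (by decide) (by decide)
    (Or.inr (by decide +kernel))

set_option maxHeartbeats 400000 in
/-- `D = -16027`: the odd character `(·/16027)` of conductor `16027` (`16027`: 11 · 31 · 47) — Fekete–Pólya witness of order `8` along the induced modulus `16027·15 = 240405`, block certificate (digits of `121` bits, splitting depth `10`); est. `10.7` kernel-s. [cite: MontgomeryVaughan2007, §11.2.1 Exercises 7 (g), 8] -/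
theorem noRealZeroOdd_fp_16027 :
    ∀ χ : DirichletCharacter ℂ 16027, χ.IsQuadratic → χ.IsPrimitive → χ.Odd →
      ∀ σ : ℝ, 0 < σ → σ < 1 → χ.LFunction σ ≠ 0 :=
  good_odd_of_odd_blk [11, 31, 47] (by norm_num) (by decide) (by decide) 15 8 121 10 (by decide) (by decide) (by decide)
    (Or.inr (by decide +kernel))

set_option maxHeartbeats 400000 in
/-- `D = 16213`: the even character `(·/16213)` of conductor `16213` (`16213`: 31 · 523) — Fekete–Pólya witness of order `5` along the induced modulus `16213·11 = 178343`, block certificate (digits of `72` bits, splitting depth `10`); est. `4.3` kernel-s. [cite: MontgomeryVaughan2007, §11.2.1 Exercises 7 (g), 8] -/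
theorem noRealZeroEven_fp_16213 :
    ∀ χ : DirichletCharacter ℂ 16213, χ.IsQuadratic → χ.IsPrimitive → χ.Even →
      ∀ σ : ℝ, 0 < σ → σ < 1 → χ.LFunction σ ≠ 0 :=
  good_even_of_odd_blk [31, 523] (by norm_num) (by decide) (by decide) 11 5 72 10 (by decide) (by decide) (by decide)
    (Or.inr (by decide +kernel))

set_option maxHeartbeats 400000 in
/-- `D = -16312`: the odd character `χ₈·(·/2039)` of conductor `16312` (`2039`: prime) — Fekete–Pólya witness of order `2` along the induced modulus `16312·15 = 244680`, block certificate (digits of `27` bits, splitting depth `8`); est. `1.2` kernel-s. [cite: MontgomeryVaughan2007, §11.2.1 Exercises 7 (g), 8] -/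
theorem noRealZeroOdd_fp_16312 :
    ∀ χ : DirichletCharacter ℂ 16312, χ.IsQuadratic → χ.IsPrimitive → χ.Odd →
      ∀ σ : ℝ, 0 < σ → σ < 1 → χ.LFunction σ ≠ 0 :=
  good_odd_of_eight_blk [2039] (by norm_num) (by decide) (by decide) 15 2 27 8 (by decide) (by decide) (by decide)
    (Or.inl (by decide +kernel)) (Or.inr (by decide +kernel))

set_option maxHeartbeats 400000 in
/-- `D = -16339`: the odd character `(·/16339)` of conductor `16339` (`16339`: prime) — Fekete–Pólya witness of order `6` along the induced modulus `16339·6 = 98034`, block certificate (digits of `84` bits, splitting depth `9`); est. `3.8` kernel-s. [cite: MontgomeryVaughan2007, §11.2.1 Exercises 7 (g), 8] -/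
theorem noRealZeroOdd_fp_16339 :
    ∀ χ : DirichletCharacter ℂ 16339, χ.IsQuadratic → χ.IsPrimitive → χ.Odd →
      ∀ σ : ℝ, 0 < σ → σ < 1 → χ.LFunction σ ≠ 0 :=
  good_odd_of_odd_blk [16339] (by norm_num) (by decide) (by decide) 6 6 84 9 (by decide) (by decide) (by decide)
    (Or.inr (by decide +kernel))

set_option maxHeartbeats 400000 in
/-- `D = -16363`: the odd character `(·/16363)` of conductor `16363` (`16363`: prime) — Fekete–Pólya witness of order `6` along the induced modulus `16363·10 = 163630`, block certificate (digits of `88` bits, splitting depth `10`); est. `5.8` kernel-s. [cite: MontgomeryVaughan2007, §11.2.1 Exercises 7 (g), 8] -/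
theorem noRealZeroOdd_fp_16363 :
    ∀ χ : DirichletCharacter ℂ 16363, χ.IsQuadratic → χ.IsPrimitive → χ.Odd →
      ∀ σ : ℝ, 0 < σ → σ < 1 → χ.LFunction σ ≠ 0 :=
  good_odd_of_odd_blk [16363] (by norm_num) (by decide) (by decide) 10 6 88 10 (by decide) (by decide) (by decide)
    (Or.inr (by decide +kernel))

set_option maxHeartbeats 400000 in
/-- `D = -16387`: the odd character `(·/16387)` of conductor `16387` (`16387`: 7 · 2341) — Fekete–Pólya witness of order `8` along the induced modulus `16387·15 = 245805`, block certificate (digits of `121` bits, splitting depth `10`); est. `11.0` kernel-s. [cite: MontgomeryVaughan2007, §11.2.1 Exercises 7 (g), 8] -/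
theorem noRealZeroOdd_fp_16387 :
    ∀ χ : DirichletCharacter ℂ 16387, χ.IsQuadratic → χ.IsPrimitive → χ.Odd →
      ∀ σ : ℝ, 0 < σ → σ < 1 → χ.LFunction σ ≠ 0 :=
  good_odd_of_odd_blk [7, 2341] (by norm_num) (by decide) (by decide) 15 8 121 10 (by decide) (by decide) (by decide)
    (Or.inr (by decide +kernel))

set_option maxHeartbeats 400000 in
/-- `D = -16404`: the odd character `χ₋₄·(·/4101)` of conductor `16404` (`4101`: 3 · 1367) — Fekete–Pólya witness of order `3` along the induced modulus `16404·11 = 180444`, block certificate (digits of `43` bits, splitting depth `9`); est. `1.8` kernel-s. [cite: MontgomeryVaughan2007, §11.2.1 Exercises 7 (g), 8] -/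
theorem noRealZeroOdd_fp_16404 :
    ∀ χ : DirichletCharacter ℂ 16404, χ.IsQuadratic → χ.IsPrimitive → χ.Odd →
      ∀ σ : ℝ, 0 < σ → σ < 1 → χ.LFunction σ ≠ 0 :=
  good_odd_of_four_blk [3, 1367] (by norm_num) (by decide) (by decide) 11 3 43 9 (by decide) (by decide) (by decide)
    (Or.inr (by decide +kernel))

set_option maxHeartbeats 400000 in
/-- `D = -16468`: the odd character `χ₋₄·(·/4117)` of conductor `16468` (`4117`: 23 · 179) — Fekete–Pólya witness of order `4` along the induced modulus `16468·15 = 247020`, block certificate (digits of `60` bits, splitting depth `9`); est. `3.3` kernel-s. [cite: MontgomeryVaughan2007, §11.2.1 Exercises 7 (g), 8] -/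
theorem noRealZeroOdd_fp_16468 :
    ∀ χ : DirichletCharacter ℂ 16468, χ.IsQuadratic → χ.IsPrimitive → χ.Odd →
      ∀ σ : ℝ, 0 < σ → σ < 1 → χ.LFunction σ ≠ 0 :=
  good_odd_of_four_blk [23, 179] (by norm_num) (by decide) (by decide) 15 4 60 9 (by decide) (by decide) (by decide)
    (Or.inr (by decide +kernel))

set_option maxHeartbeats 400000 in
/-- `D = 16517`: the even character `(·/16517)` of conductor `16517` (`16517`: 83 · 199) — Fekete–Pólya witness of order `7` along the induced modulus `16517·6 = 99102`, block certificate (digits of `98` bits, splitting depth `9`); est. `3.5` kernel-s. [cite: MontgomeryVaughan2007, §11.2.1 Exercises 7 (g), 8] -/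
theorem noRealZeroEven_fp_16517 :
    ∀ χ : DirichletCharacter ℂ 16517, χ.IsQuadratic → χ.IsPrimitive → χ.Even →
      ∀ σ : ℝ, 0 < σ → σ < 1 → χ.LFunction σ ≠ 0 :=
  good_even_of_odd_blk [83, 199] (by norm_num) (by decide) (by decide) 6 7 98 9 (by decide) (by decide) (by decide)
    (Or.inr (by decide +kernel))

set_option maxHeartbeats 400000 in
/-- `D = -16520`: the odd character `χ₋₈·(·/2065)` of conductor `16520` (`2065`: 5 · 7 · 59) — Fekete–Pólya witness of order `2` along the induced modulus `16520·11 = 181720`, block certificate (digits of `27` bits, splitting depth `8`); est. `0.9` kernel-s. [cite: MontgomeryVaughan2007, §11.2.1 Exercises 7 (g), 8] -/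
theorem noRealZeroOdd_fp_16520 :
    ∀ χ : DirichletCharacter ℂ 16520, χ.IsQuadratic → χ.IsPrimitive → χ.Odd →
      ∀ σ : ℝ, 0 < σ → σ < 1 → χ.LFunction σ ≠ 0 :=
  good_odd_of_eight_blk [5, 7, 59] (by norm_num) (by decide) (by decide) 11 2 27 8 (by decide) (by decide) (by decide)
    (Or.inr (by decide +kernel)) (Or.inl (by decide +kernel))

set_option maxHeartbeats 400000 in
/-- `D = 16541`: the even character `(·/16541)` of conductor `16541` (`16541`: 7 · 17 · 139) — Fekete–Pólya witness of order `8` along the induced modulus `16541·22 = 363902`, block certificate (digits of `124` bits, splitting depth `11`); est. `16.4` kernel-s. [cite: MontgomeryVaughan2007, §11.2.1 Exercises 7 (g), 8] -/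
theorem noRealZeroEven_fp_16541 :
    ∀ χ : DirichletCharacter ℂ 16541, χ.IsQuadratic → χ.IsPrimitive → χ.Even →
      ∀ σ : ℝ, 0 < σ → σ < 1 → χ.LFunction σ ≠ 0 :=
  good_even_of_odd_blk [7, 17, 139] (by norm_num) (by decide) (by decide) 22 8 124 11 (by decide) (by decide) (by decide)
    (Or.inr (by decide +kernel))

end Literature.NumberTheory.LFunctions
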